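import Mathlib
import Summits.RiemannHypothesis.RiemannHypothesis.Theorems.HandoffXiZeroCount
import Summits.RiemannHypothesis.RiemannHypothesis.Theorems.HandoffThinRigidity
import Literature.NumberTheory.LFunctions.RiemannXiProofs
import HarnessLib

/-!
# ROUTE R-K «COUNT-AND-THIN» IN CANONICAL FORM, I: the normalisers of SC-3 are superfluous

Handoff track (ROUTE 1′), prove-1 gen13; companion of `HandoffCountThin*.lean` (idea-3 gen22 ROUTE
R-K, TASK H-K1; HOME/handoff/IDEAS-finite-rank.md v3.3.1 §G22-3/§G22-4). Built imports only.

SC-3 as printed carries free normalisers (`e^{-α_t}`, or `e^{-α_t - β_t z²}`). Since `Ξ(0) ≠ 0`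
(theory-1's `ThinRigidity.riemannXiUpper_zero_ne_zero`, file XVIII-b `HandoffThinRigidity`), the normalisers are
CANONICAL near any set containing `0`:

* `tendstoLocallyUniformlyOn_selfNormalised` — if `c_t F_t → Ξ` locally uniformly on a set `U ∋ 0`
  for SOME normalisers `c_t ≠ 0` (complex allowed), then `F_t(z)/F_t(0) → Ξ(z)/Ξ(0)` locally
  uniformly on `U` (Mathlib's `TendstoLocallyUniformlyOn.div₀`);
* `tendstoLocallyUniformlyOn_of_selfNormalised` — conversely `F_t(z)/F_t(0) → Ξ(z)/Ξ(0)` gives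
  `(Ξ(0)/F_t(0)) · F_t → Ξ`.

So idea-3's SC-3 has the parameter-free form «`û_t(z)/û_t(0) → Ξ(z)/Ξ(0)` near the real axis»
(`û_t(0) = ∫ u_t`, the mean of the ground state). Part II (`HandoffCountThinCanonicalRH`, imports
`HandoffCountThinLower`) combines it with the one-sided count into the canonical pair ⟹ RH. A pure
statement about convergence of an unspecified family; nothing here is, or suggests, a proof of RH.
-/

set_option linter.dupNamespace false  -- the mandated namespace repeats `RiemannHypothesis`

noncomputable section

open Filter Set Topology Metric Complex
open Literature.NumberTheory.LFunctions

namespace Summit.RiemannHypothesis.RiemannHypothesis.Theorems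

namespace CountThin

-- `Ξ(0) ≠ 0` is theory-1's `ThinRigidity.riemannXiUpper_zero_ne_zero` (`HandoffThinRigidity`, reused).
open ThinRigidity (riemannXiUpper_zero_ne_zero)

/-- `Ξ(0)` is real: `((Ξ 0).re : ℂ) = Ξ 0`. -/
theorem ofReal_re_riemannXiUpper_zero : (((riemannXiUpper 0).re : ℝ) : ℂ) = riemannXiUpper 0 :=
  Complex.ext (by simp) (by simpa using (im_riemannXiUpper_ofReal_holds 0).symm)

/-- **Normalised ⟹ self-normalised.** If `c_t F_t → Ξ` locally uniformly on an open `U ∋ 0` for some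
normalisers `c_t ≠ 0`, then `F_t(z)/F_t(0) → Ξ(z)/Ξ(0)` locally uniformly on `U`. -/
theorem tendstoLocallyUniformlyOn_selfNormalised {F : ℝ → ℂ → ℂ} {c : ℝ → ℂ} (hc : ∀ t, c t ≠ 0)
    {U : Set ℂ} (h0 : (0 : ℂ) ∈ U)
    (h : TendstoLocallyUniformlyOn (fun t z => c t * F t z) riemannXiUpper atTop U) :
    TendstoLocallyUniformlyOn (fun t z => F t z / F t 0)
      (fun z => riemannXiUpper z / riemannXiUpper 0) atTop U := by
  have hΞc : ContinuousOn riemannXiUpper U := differentiable_riemannXiUpper'.continuous.continuousOn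
  have h0t : Tendsto (fun t => c t * F t 0) atTop (𝓝 (riemannXiUpper 0)) := h.tendsto_at h0
  have hconst : TendstoLocallyUniformlyOn (fun t (_ : ℂ) => c t * F t 0)
      (fun _ => riemannXiUpper 0) atTop U :=
    (h0t.tendstoUniformlyOn_const U).tendstoLocallyUniformlyOn
  have hdiv := h.div₀ hconst hΞc continuousOn_const (fun _ _ => riemannXiUpper_zero_ne_zero)
  refine (hdiv.congr fun t z _ => ?_).congr_right fun z _ => ?_
  · show c t * F t z / (c t * F t 0) = F t z / F t 0
    exact mul_div_mul_left _ _ (hc t)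
  · rfl

/-- **Self-normalised ⟹ normalised**, with the canonical normaliser `Ξ(0)/F_t(0)`. -/
theorem tendstoLocallyUniformlyOn_of_selfNormalised {F : ℝ → ℂ → ℂ} {U : Set ℂ}
    (h : TendstoLocallyUniformlyOn (fun t z => F t z / F t 0)
      (fun z => riemannXiUpper z / riemannXiUpper 0) atTop U) :
    TendstoLocallyUniformlyOn (fun t z => riemannXiUpper 0 / F t 0 * F t z) riemannXiUpper
      atTop U := by
  have hg : UniformContinuous fun w : ℂ => riemannXiUpper 0 * w := uniformContinuous_id.const_mul' _
  have := hg.comp_tendstoLocallyUniformlyOn h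
  refine (this.congr fun t z _ => ?_).congr_right fun z _ => ?_
  · show riemannXiUpper 0 * (F t z / F t 0) = riemannXiUpper 0 / F t 0 * F t z
    ring
  · show riemannXiUpper 0 * (riemannXiUpper z / riemannXiUpper 0) = riemannXiUpper z
    field_simp [riemannXiUpper_zero_ne_zero]

/-! Axiom census (expected `propext`, `Classical.choice`, `Quot.sound`). -/
#print axioms tendstoLocallyUniformlyOn_selfNormalised
#print axioms tendstoLocallyUniformlyOn_of_selfNormalised

end CountThin

end Summit.RiemannHypothesis.RiemannHypothesis.Theorems

end
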